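import Summits.MatrixMultiplication.MatrixMultiplication.Theorems.OutsiderSandwichBorderTableLaws
import HarnessLib

/-!
# Degenerations compose (BCS (15.24)(2)) and the composition law of the border table

Route `OutsiderSandwich` (decomposition cell `decomp-mm`, lens 4, gen 29), support for the aside
leaf `BlockOneIsMM` (stmt-MatrixMultiplication-27147).  Continues `OutsiderSandwichBorderTable(Laws)`.

1. **Transitivity of degeneration** (BCS Lemma (15.24)(2), the step the tree's degeneration
   calculus `DegenerationSpectralMonotone` lacked: only `restriction ∘ degeneration` was typed).
   If `t ⊴_h s` (an approximate restriction of order `h`, `IsApproxRestriction h s t …`) and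
   `u ⊴_{h'} t`, then `u ⊴_{h(h'+1)+h'} s`: substitute `ε ↦ ε^{h'+1}` in the first family of
   matrices (`Polynomial.expand`), which pushes its error term beyond `ε^{h(h'+1)+h'}`
   (`coeff_expand_stage`), and compose (`isApproxRestriction_trans`, `algDegeneratesTo_trans`).
   With BCS's numbering `q = h + 1`, `p = h' + 1` the order is `pq - 1`, exactly (15.24)(2).
2. **Composition law of the border table**: `AmortisedDeg N B m₁ → AmortisedDeg N' m₁ m →
   AmortisedDeg (N + N') B m` (re-use the `m₁` level-`N` products as the helper blocks of level
   `N'`), hence `a̲(N + N', m) ≤ a̲(N, a̲(N', m))`, each further level costs at most the level-one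
   factor: `a̲(N + 1, m) ≤ ⌈4 a̲(N, m) / 3⌉`, and at level two `a̲(2, m) ≤ ⌈4 ⌈4m/3⌉ / 3⌉`
   (better than `2m` for `m = 6` and `m ≥ 8`; e.g. `a̲(2, 6) ≤ 11`, `a̲(2, 9) ≤ 16`), while the
   window at `m = 2` is `3 ≤ a̲(2, 2) ≤ 4`.

## References
* P. Bürgisser, M. Clausen, M. A. Shokrollahi, *Algebraic Complexity Theory*, Springer 1997,
  Lemma (15.24)(2) and its proof (p. 422), Prop. (15.25). [BurgisserClausenShokrollahi1997]
* V. Strassen, *Relative bilinear complexity and matrix multiplication*, J. reine angew. Math.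
  375/376 (1987) 406–443, §4 (degeneration order). [Strassen1987]
* D. Coppersmith, S. Winograd, *Matrix multiplication via arithmetic progressions*,
  J. Symbolic Comput. 9 (1990) 251–280, §7. [CoppersmithWinograd1990]
-/

noncomputable section

open scoped BigOperators Polynomial

set_option linter.dupNamespace false
set_option autoImplicit false

namespace Summit.MatrixMultiplication.MatrixMultiplication.Theorems.OutsiderSandwichBorderComposition

open Polynomial (expand)
open Literature.Computability.AlgebraicComplexity
open Summit.MatrixMultiplication.MatrixMultiplication.Theorems.OutsiderSandwichCoupling (coupling₁)
open Summit.MatrixMultiplication.MatrixMultiplication.Theorems.OutsiderSandwichAmortised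
  (mk_unit_kronecker_pow)
open Summit.MatrixMultiplication.MatrixMultiplication.Theorems.OutsiderSandwichBorderExchange
  (restrictsTo_of_mk_eq)
open Summit.MatrixMultiplication.MatrixMultiplication.Theorems.OutsiderSandwichBorderTable
  (AmortisedDeg borderAmortisedNumber amortisedDeg_borderAmortisedNumber borderAmortisedNumber_le
    borderAmortisedNumber_one amortisedDeg_mul_two_pow)
open Summit.MatrixMultiplication.MatrixMultiplication.Theorems.OutsiderSandwichBorderTableLaws
  (ceil_le_borderAmortisedNumber_two borderAmortisedNumber_two_le)

/-! ## 1. Degenerations compose -/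

section Trans

universe u

variable {K : Type u} [CommSemiring K]
variable {ι κ μ ι' κ' μ' ι'' κ'' μ'' : Type*}

/-- After the substitution `ε ↦ ε^M` an approximate restriction of order `h` has lead term at
`ε^{hM}` and NO other term below `ε^{(h+1)M}` (BCS (15.24)(2), proof: "replace `ε` by `ε^p`").
[cite: BurgisserClausenShokrollahi1997, Lemma (15.24)(2)] -/
theorem coeff_expand_stage [Fintype ι] [Fintype κ] [Fintype μ] {h M : ℕ} (hM : 0 < M)
    {s : ι → κ → μ → K} {t : ι' → κ' → μ' → K} {A : ι' → ι → K[X]} {B : κ' → κ → K[X]}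
    {C : μ' → μ → K[X]} (hd : IsApproxRestriction h s t A B C) (x : ι') (y : κ') (z : μ')
    (j : ℕ) (hj : j < (h + 1) * M) :
    (∑ a, ∑ b, ∑ c, expand K M (A x a) * expand K M (B y b) * expand K M (C z c) *
        Polynomial.C (s a b c)).coeff j = if j = h * M then t x y z else 0 := by
  have hsum : (∑ a, ∑ b, ∑ c, expand K M (A x a) * expand K M (B y b) * expand K M (C z c) *
        Polynomial.C (s a b c)) =
      expand K M (∑ a, ∑ b, ∑ c, A x a * B y b * C z c * Polynomial.C (s a b c)) := by
    simp only [map_sum, map_mul, Polynomial.expand_C]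
  rw [hsum, Polynomial.coeff_expand hM]
  by_cases hdvd : M ∣ j
  · obtain ⟨i, rfl⟩ := hdvd
    have hi : i ≤ h := by
      have : M * i < M * (h + 1) := by rwa [mul_comm (h + 1) M] at hj
      exact Nat.lt_succ_iff.mp (Nat.lt_of_mul_lt_mul_left this)
    rw [if_pos (dvd_mul_right M i), Nat.mul_div_cancel_left i hM, hd x y z i hi]
    by_cases hih : i = h
    · subst hih
      rw [if_pos rfl, if_pos (mul_comm _ _)]
    · rw [if_neg hih, if_neg]
      intro hc
      exact hih (Nat.eq_of_mul_eq_mul_left hM (by rw [hc, mul_comm]))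
  · rw [if_neg hdvd, if_neg]
    rintro rfl
    exact hdvd (dvd_mul_left M h)

/-- Coefficients of `P · q` below the stage of `q`: if `q ≡ c ε^e` up to order `n`, then
`(P q)_j = P_{j-e} c` for `e ≤ j ≤ n` and `0` for `j < e`. [folklore] -/
theorem coeff_mul_stage {P q : K[X]} {e n : ℕ} {c : K}
    (hq : ∀ j' ≤ n, q.coeff j' = if j' = e then c else 0) (j : ℕ) (hj : j ≤ n) :
    (P * q).coeff j = if e ≤ j then P.coeff (j - e) * c else 0 := by
  rw [Polynomial.coeff_mul]
  split_ifs with hej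
  · rw [Finset.sum_eq_single (j - e, e)]
    · rw [hq e (le_trans hej hj), if_pos rfl]
    · rintro ⟨a, b⟩ hab hne
      have hab' : a + b = j := by simpa using hab
      rw [hq b (by omega)]
      by_cases hbe : b = e
      · subst hbe
        exact (hne (Prod.ext (by dsimp; omega) rfl)).elim
      · rw [if_neg hbe, mul_zero]
    · intro hmem
      exact (hmem (by simp; omega)).elim
  · refine Finset.sum_eq_zero fun ab hab => ?_
    have hab' : ab.1 + ab.2 = j := by simpa using hab
    rw [hq ab.2 (by omega), if_neg (by omega), mul_zero]

/-- **Degenerations compose** (BCS Lemma (15.24)(2): `φ ⊴_p χ`, `χ ⊴_q ψ ⟹ φ ⊴_{pq} ψ`): an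
approximate restriction `t ⊴_h s` followed by `u ⊴_{h'} t` gives `u ⊴_{h(h'+1)+h'} s`, with the
matrices `A'' = A' · A(ε^{h'+1})` (first family reparametrised by `ε ↦ ε^{h'+1}`).
[cite: BurgisserClausenShokrollahi1997, Lemma (15.24)(2)] -/
theorem isApproxRestriction_trans [Fintype ι] [Fintype κ] [Fintype μ] [Fintype ι'] [Fintype κ']
    [Fintype μ'] {h h' : ℕ} {s : ι → κ → μ → K} {t : ι' → κ' → μ' → K} {u : ι'' → κ'' → μ'' → K}
    {A : ι' → ι → K[X]} {B : κ' → κ → K[X]} {C : μ' → μ → K[X]}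
    (hd : IsApproxRestriction h s t A B C) {A' : ι'' → ι' → K[X]} {B' : κ'' → κ' → K[X]}
    {C' : μ'' → μ' → K[X]} (hd' : IsApproxRestriction h' t u A' B' C') :
    IsApproxRestriction (h * (h' + 1) + h') s u
      (fun x a => ∑ a', A' x a' * expand K (h' + 1) (A a' a))
      (fun y b => ∑ b', B' y b' * expand K (h' + 1) (B b' b))
      (fun z c => ∑ c', C' z c' * expand K (h' + 1) (C c' c)) := by
  intro x y z j hj
  have hsum : (∑ a, ∑ b, ∑ c, (∑ a', A' x a' * expand K (h' + 1) (A a' a)) *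
      (∑ b', B' y b' * expand K (h' + 1) (B b' b)) *
      (∑ c', C' z c' * expand K (h' + 1) (C c' c)) * Polynomial.C (s a b c)) =
      ∑ a', ∑ b', ∑ c', (A' x a' * B' y b' * C' z c') *
        ∑ a, ∑ b, ∑ c, expand K (h' + 1) (A a' a) * expand K (h' + 1) (B b' b) *
          expand K (h' + 1) (C c' c) * Polynomial.C (s a b c) := by
    simp only [sum_mul_sum_mul_sum_mul]
    simp only [Finset.mul_sum]
    -- LHS binders `a b c a' b' c'`, RHS binders `a' b' c' a b c`
    rw [sum_comm₃]
    refine Finset.sum_congr rfl fun a' _ => Finset.sum_congr rfl fun b' _ =>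
      Finset.sum_congr rfl fun c' _ => Finset.sum_congr rfl fun a _ =>
      Finset.sum_congr rfl fun b _ => Finset.sum_congr rfl fun c _ => ?_
    ring
  have hstage : ∀ a' b' c', ∀ j' ≤ h * (h' + 1) + h',
      (∑ a, ∑ b, ∑ c, expand K (h' + 1) (A a' a) * expand K (h' + 1) (B b' b) *
          expand K (h' + 1) (C c' c) * Polynomial.C (s a b c)).coeff j' =
        if j' = h * (h' + 1) then t a' b' c' else 0 :=
    fun a' b' c' j' hj' => coeff_expand_stage (M := h' + 1) (by omega) hd a' b' c' j'
      (by rw [add_mul, one_mul]; omega)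
  rw [hsum, Polynomial.finsetSum_coeff]
  have hterm : ∀ a' b' c', ((A' x a' * B' y b' * C' z c') *
      ∑ a, ∑ b, ∑ c, expand K (h' + 1) (A a' a) * expand K (h' + 1) (B b' b) *
        expand K (h' + 1) (C c' c) * Polynomial.C (s a b c)).coeff j =
      if h * (h' + 1) ≤ j then (A' x a' * B' y b' * C' z c').coeff (j - h * (h' + 1)) * t a' b' c'
      else 0 :=
    fun a' b' c' => coeff_mul_stage (hstage a' b' c') j hj
  simp only [Polynomial.finsetSum_coeff, hterm]
  by_cases hle : h * (h' + 1) ≤ j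
  · simp only [if_pos hle]
    have key := hd' x y z (j - h * (h' + 1)) (by omega)
    simp only [Polynomial.finsetSum_coeff, Polynomial.coeff_mul_C] at key
    rw [key]
    by_cases hjt : j = h * (h' + 1) + h'
    · rw [if_pos hjt, if_pos (by omega)]
    · rw [if_neg hjt, if_neg (by omega)]
  · simp only [if_neg hle, Finset.sum_const_zero]
    rw [if_neg (by omega)]

/-- **`⊴` is transitive**: `t ⊴ s`, `u ⊴ t ⟹ u ⊴ s` (BCS Prop. (15.25): the degeneration is a
preorder). [cite: BurgisserClausenShokrollahi1997, Prop. (15.25)] -/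
theorem algDegeneratesTo_trans [Fintype ι] [Fintype κ] [Fintype μ] [Fintype ι'] [Fintype κ']
    [Fintype μ'] {s : ι → κ → μ → K} {t : ι' → κ' → μ' → K} {u : ι'' → κ'' → μ'' → K}
    (hst : AlgDegeneratesTo s t) (htu : AlgDegeneratesTo t u) : AlgDegeneratesTo s u := by
  obtain ⟨h, A, B, C, hd⟩ := hst
  obtain ⟨h', A', B', C', hd'⟩ := htu
  exact ⟨_, _, _, _, isApproxRestriction_trans hd hd'⟩

/-- Three-step chains `s ⊵ t ⊵ u ⊵ v`. [cite: BurgisserClausenShokrollahi1997, Prop. (15.25)] -/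
theorem algDegeneratesTo_trans₃ [Fintype ι] [Fintype κ] [Fintype μ] [Fintype ι'] [Fintype κ']
    [Fintype μ'] [Fintype ι''] [Fintype κ''] [Fintype μ''] {ι₃ κ₃ μ₃ : Type*}
    {s : ι → κ → μ → K} {t : ι' → κ' → μ' → K} {u : ι'' → κ'' → μ'' → K} {v : ι₃ → κ₃ → μ₃ → K}
    (hst : AlgDegeneratesTo s t) (htu : AlgDegeneratesTo t u) (huv : AlgDegeneratesTo u v) :
    AlgDegeneratesTo s v :=
  algDegeneratesTo_trans (algDegeneratesTo_trans hst htu) huv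

end Trans

/-! ## 2. The composition law of the border table -/

/-- `[⟨B⟩ ⊠ t^{⊠N} ⊠ u^{⊠N'}] = B [t]^N [u]^{N'}` in `T(ℂ)`. [cite: Zuiddam2018, §2.3] -/
theorem mk_kronecker_unit_kronecker_pow {ι κ μ ι₁ κ₁ μ₁ : Type} [Fintype ι] [Fintype κ]
    [Fintype μ] [DecidableEq ι] [DecidableEq κ] [DecidableEq μ] [Fintype ι₁] [Fintype κ₁]
    [Fintype μ₁] [DecidableEq ι₁] [DecidableEq κ₁] [DecidableEq μ₁] (t : ι → κ → μ → ℂ)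
    (u : ι₁ → κ₁ → μ₁ → ℂ) (B N N' : ℕ) :
    TensorClass.mk (kroneckerTensor (kroneckerTensor (unitTensor ℂ B) (kroneckerPow t N))
        (kroneckerPow u N')) =
      (B : TensorClass ℂ) * TensorClass.mk t ^ N * TensorClass.mk u ^ N' := by
  rw [← TensorClass.mk_mul_mk, mk_unit_kronecker_pow, ← TensorClass.mk_pow]

/-- **Composition law**: `AmortisedDeg N B m₁ → AmortisedDeg N' m₁ m → AmortisedDeg (N + N') B m`
— degenerate `⟨B⟩ ⊠ C₁^{⊠(N+N')} = (⟨B⟩ ⊠ C₁^{⊠N}) ⊠ C₁^{⊠N'} ⊵ ⟨m₁⟩ ⊠ ⟨2,2,2⟩^{⊠N} ⊠ C₁^{⊠N'}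
= (⟨m₁⟩ ⊠ C₁^{⊠N'}) ⊠ ⟨2,2,2⟩^{⊠N} ⊵ ⟨m⟩ ⊠ ⟨2,2,2⟩^{⊠(N+N')}`, the two degenerations glued by
transitivity (§1). [cite: BurgisserClausenShokrollahi1997, Lemma (15.24)(2)] -/
theorem amortisedDeg_comp {N N' B m₁ m : ℕ} (h : AmortisedDeg N B m₁) (h' : AmortisedDeg N' m₁ m) :
    AmortisedDeg (N + N') B m := by
  have e1 : TensorClass.mk (kroneckerTensor (kroneckerTensor (unitTensor ℂ B)
        (kroneckerPow coupling₁ N)) (kroneckerPow coupling₁ N')) =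
      TensorClass.mk (kroneckerTensor (unitTensor ℂ B) (kroneckerPow coupling₁ (N + N'))) := by
    rw [mk_kronecker_unit_kronecker_pow, mk_unit_kronecker_pow, pow_add, mul_assoc]
  have e2 : TensorClass.mk (kroneckerTensor (kroneckerTensor (unitTensor ℂ m₁)
        (kroneckerPow coupling₁ N')) (kroneckerPow (matMulTensor ℂ 2 2 2) N)) =
      TensorClass.mk (kroneckerTensor (kroneckerTensor (unitTensor ℂ m₁)
        (kroneckerPow (matMulTensor ℂ 2 2 2) N)) (kroneckerPow coupling₁ N')) := by
    rw [mk_kronecker_unit_kronecker_pow, mk_kronecker_unit_kronecker_pow]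
    ring
  have e3 : TensorClass.mk (kroneckerTensor (unitTensor ℂ m)
        (kroneckerPow (matMulTensor ℂ 2 2 2) (N + N'))) =
      TensorClass.mk (kroneckerTensor (kroneckerTensor (unitTensor ℂ m)
        (kroneckerPow (matMulTensor ℂ 2 2 2) N')) (kroneckerPow (matMulTensor ℂ 2 2 2) N)) := by
    rw [mk_kronecker_unit_kronecker_pow, mk_unit_kronecker_pow, pow_add]
    ring
  have d1 : AlgDegeneratesTo (kroneckerTensor (kroneckerTensor (unitTensor ℂ B)
        (kroneckerPow coupling₁ N)) (kroneckerPow coupling₁ N'))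
      (kroneckerTensor (kroneckerTensor (unitTensor ℂ m₁) (kroneckerPow (matMulTensor ℂ 2 2 2) N))
        (kroneckerPow coupling₁ N')) :=
    h.kronecker (TensorRestrictsTo.refl _).algDegeneratesTo
  have d2 : AlgDegeneratesTo (kroneckerTensor (kroneckerTensor (unitTensor ℂ m₁)
        (kroneckerPow coupling₁ N')) (kroneckerPow (matMulTensor ℂ 2 2 2) N))
      (kroneckerTensor (kroneckerTensor (unitTensor ℂ m) (kroneckerPow (matMulTensor ℂ 2 2 2) N'))
        (kroneckerPow (matMulTensor ℂ 2 2 2) N)) :=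
    h'.kronecker (TensorRestrictsTo.refl _).algDegeneratesTo
  exact (algDegeneratesTo_trans (((restrictsTo_of_mk_eq e1).algDegeneratesTo_trans
    d1).trans_restrictsTo (restrictsTo_of_mk_eq e2)) d2).trans_restrictsTo (restrictsTo_of_mk_eq e3)

/-- **`a̲(N + N', m) ≤ a̲(N, a̲(N', m))`.** [cite: BurgisserClausenShokrollahi1997, Lemma (15.24)(2)] -/
theorem borderAmortisedNumber_comp_le (N N' m : ℕ) :
    borderAmortisedNumber (N + N') m ≤ borderAmortisedNumber N (borderAmortisedNumber N' m) :=
  borderAmortisedNumber_le (amortisedDeg_comp (amortisedDeg_borderAmortisedNumber N _)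
    (amortisedDeg_borderAmortisedNumber N' m))

/-- **Each further level costs at most the level-one factor**: `a̲(N + 1, m) ≤ ⌈4 a̲(N, m)/3⌉`
(`a̲(1, k) = ⌈4k/3⌉`, `borderAmortisedNumber_one`). [new] -/
theorem borderAmortisedNumber_succ_le (N m : ℕ) :
    borderAmortisedNumber (N + 1) m ≤ (4 * borderAmortisedNumber N m + 2) / 3 := by
  have := borderAmortisedNumber_comp_le 1 N m
  rwa [borderAmortisedNumber_one, Nat.add_comm] at this

/-- The other order: `a̲(N + 1, m) ≤ a̲(N, ⌈4m/3⌉)`. [new] -/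
theorem borderAmortisedNumber_succ_le' (N m : ℕ) :
    borderAmortisedNumber (N + 1) m ≤ borderAmortisedNumber N ((4 * m + 2) / 3) := by
  have := borderAmortisedNumber_comp_le N 1 m
  rwa [borderAmortisedNumber_one] at this

/-- **Level two through level one twice**: `a̲(2, m) ≤ ⌈4 ⌈4m/3⌉ / 3⌉`. [new] -/
theorem borderAmortisedNumber_two_le_comp (m : ℕ) :
    borderAmortisedNumber 2 m ≤ (4 * ((4 * m + 2) / 3) + 2) / 3 := by
  have := borderAmortisedNumber_succ_le 1 m
  rwa [borderAmortisedNumber_one] at this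

/-- The composed bound against the floor and the door bound `2m`, tabulated:
`a̲(2, 6) ∈ [7, 11]`, `a̲(2, 8) ∈ [10, 15]`, `a̲(2, 9) ∈ [11, 16]` (composition beats `2m`), while
`a̲(2, 2) ∈ [3, 4]` and `a̲(2, 7) ∈ [8, 14]` (no gain at the rung). [new] -/
theorem borderAmortisedNumber_two_windows :
    (3 ≤ borderAmortisedNumber 2 2 ∧ borderAmortisedNumber 2 2 ≤ 4) ∧
    (7 ≤ borderAmortisedNumber 2 6 ∧ borderAmortisedNumber 2 6 ≤ 11) ∧
    (10 ≤ borderAmortisedNumber 2 8 ∧ borderAmortisedNumber 2 8 ≤ 15) ∧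
    (11 ≤ borderAmortisedNumber 2 9 ∧ borderAmortisedNumber 2 9 ≤ 16) := by
  refine ⟨⟨?_, ?_⟩, ⟨?_, ?_⟩, ⟨?_, ?_⟩, ⟨?_, ?_⟩⟩
  · have := ceil_le_borderAmortisedNumber_two 2; omega
  · have := borderAmortisedNumber_two_le 2; omega
  · have := ceil_le_borderAmortisedNumber_two 6; omega
  · have := borderAmortisedNumber_two_le_comp 6; omega
  · have := ceil_le_borderAmortisedNumber_two 8; omega
  · have := borderAmortisedNumber_two_le_comp 8; omega
  · have := ceil_le_borderAmortisedNumber_two 9; omega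
  · have := borderAmortisedNumber_two_le_comp 9; omega

/-- Asymptotically the composed bound is `(4/3)^N m`: `a̲(N, m) · 3^N ≤ 4^N m + 2 (4^N - 3^N)`,
i.e. `a̲(N, m) ≤ (4/3)^N (m + 2) - 2`. [new] -/
theorem borderAmortisedNumber_pow_le (N m : ℕ) :
    borderAmortisedNumber N m * 3 ^ N + 2 * 3 ^ N ≤ (m + 2) * 4 ^ N := by
  induction N with
  | zero =>
    have := borderAmortisedNumber_le (amortisedDeg_mul_two_pow 0 m)
    simp only [pow_zero, mul_one] at this ⊢
    omega
  | succ n ih =>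
    have hs := borderAmortisedNumber_succ_le n m
    have h3 : (4 * borderAmortisedNumber n m + 2) / 3 * 3 ≤ 4 * borderAmortisedNumber n m + 2 :=
      Nat.div_mul_le_self _ _
    calc borderAmortisedNumber (n + 1) m * 3 ^ (n + 1) + 2 * 3 ^ (n + 1)
        = (borderAmortisedNumber (n + 1) m * 3 + 2 * 3) * 3 ^ n := by ring
      _ ≤ ((4 * borderAmortisedNumber n m + 2) + 2 * 3) * 3 ^ n := by
          apply Nat.mul_le_mul_right
          have := Nat.mul_le_mul_right 3 hs
          omega
      _ = 4 * (borderAmortisedNumber n m * 3 ^ n + 2 * 3 ^ n) := by ring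
      _ ≤ 4 * ((m + 2) * 4 ^ n) := Nat.mul_le_mul_left 4 ih
      _ = (m + 2) * 4 ^ (n + 1) := by ring

end Summit.MatrixMultiplication.MatrixMultiplication.Theorems.OutsiderSandwichBorderComposition
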